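import Literature.MathematicalPhysics.QuantumFieldTheory.Volkov2017.ImportanceSamplingToy
import HarnessLib

/-!
# Volkov 2024 (PRD 110, 036001) §IV.A «stabilization terms … prevent from significant underestimation of |I(z)|» and NPB 961 §1 «an underestimation … leads to an infinite value ∫ f²/g … a total overestimation … leads to poor convergence too» — WHAT A FLOOR COMPONENT BUYS AND WHAT IT COSTS, in the printed one-coordinate power-law model of PRD 96 §III.A (V3a's `Volkov2017.ImportanceSamplingToy`): with `g = (1−c)·g_b + c·g_d` (main exponent `b`, floor exponent `d`, floor weight `c`) and the integrand `f_a`, (i) the weight `f/g` is BOUNDED on `(0,1]` as soon as `d ≤ a`, by `(a/(c·d))·x×^{a−d}` where `x× = (c·d/((1−c)·b))^{1/(b−d)}` is the CROSSOVER depth at which the two components are equal — whatever the main exponent `b` (which alone gives an unbounded weight for `b > a` and an infinite second moment for `b ≥ 2a`); (ii) the second moment is at most `c⁻¹·a²/(d(2a−d))` for `d < 2a`; (iii) the PRICE: for `d < 2a < b` it is at least `a²/(2(1−c)·b·(b−2a))·(x×^{−(b−2a)} − 1)`, which grows like `c^{−(b−2a)/(b−d)}` as the floor weight `c → 0` — all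 PROVED

independent recomputation; certified where stated, statistical where stated; no new-physics claim.

CITATION HEADER (venture `QEDPrecision`, cell `pub-qed`, track TROPICAL seat V3b = `pub-qed-trop-v3-lit-2` gen 13; VALUE-FREE: closed forms and
inequalities in a ONE-COORDINATE TOY with symbolic exponents `a, b, d` and weight `c`; no Feynman graph, nothing per word, nothing of X352).
Companion of V3a's `Volkov2017/ImportanceSamplingToy.lean` (`fToy a x = a·x^{a−1}`, `gToy b x = b·x^{b−1}`, `weight_toy_eq`, `sq_div_toy_eq`,
`truncSecondMoment_toy`, the tail index `b/(b−a)`), of V3a's `Volkov2018/MixtureDensitySecondMoment.lean` (the GENERAL mechanism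
`∫ f²/(Σ C_i g_i) ≤ C_j⁻¹ ∫ f²/g_j` on a measure space and the constant-`Deg` floor `g₃`, `D = 0.75`) and of `Volkov2024/SamplingDensityParameters.lean`
(the printed 2018 / 2024 weights and `D`). NEW here: the crossover depth, the BOUNDED-WEIGHT statement (i) and the LOWER bound (iii) — the
quantitative content of `tropical/view/V3-VOLKOV-DEGREES.md` §B.8 (iii) / §B.12.3 / §B.52 («finite variance only below the crossover depth;
the price is in the constants»). Statement (i) is, in this toy's closed form and sharpened by the crossover factor `x×^{a−d} ≤ 1`, the
«defensive mixture» bound of importance sampling — mixing a component under which the weight is bounded bounds the mixture weight by `1/c`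
times that bound [cite: Hesterberg1995; Owen2013, Ch. 9 §9.11] (finite-sample-space form in the tree: `Literature/Probability/ImportanceSampling/DefensiveMixture.lean`).
Nothing of the companions is re-declared.

Sources, VERBATIM.
* [Volkov2024] S. Volkov, Phys. Rev. D 110, 036001 (2024) = arXiv:2404.00649v2, §IV.A (tex `amm5_a1_all.tex` l.454–517; PDF p.9–10): «we use the
  predefined probability density functions of the form g(z) = C_main × g₀(z) + C_min × g_min(z) + C_uniform × g_uniform(z) + C_modify × (1/N)
  Σ g_i(z) … Deg_min(s) = D … C_min = 0.002, C_uniform = 0.06, C_modify = 0.02, C_main = 0.918, D = 0.75 … The function g₀(z) is designed in such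
  a way to be "near" to C|I(z)|. The remaining terms of g(z) are stabilization terms; they prevent from significant underestimation of |I(z)|,
  which can lead to poor Monte Carlo convergence.»; §IV.B.1 (PDF p.10): «we can not guarantee this [∫I²/g₀ < ∞] for all orders; moreover,
  examples of high order are known that result in an infinite integral».
* [Volkov2020] S. Volkov, Nucl. Phys. B 961 (2020) 115232 = arXiv:1912.04885v4, §1 (journal p.5; tex l.121): «When f(z) is not square-integrable
  and the number of variables is large, the PDF should be chosen very accurately: on the one hand, an underestimation of the asymptotic growth
  rate near the boundary even for one variable and for one sector leads to an infinite value ∫ f(z)²/g(z) dz and to poor and unstable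
  convergence (as a consequence); on the other hand, a total overestimation of this growth rate leads to poor convergence too.»
* [Volkov2018] S. Volkov, Phys. Rev. D 98, 076018 (2018) = arXiv:1807.05281, §IV.E (l.1006–1043): «g(z) = C₁g₁(z) + C₂g₂(z) + C₃g₃(z) + C₄g₄(z)
  … g₃ is defined by (13), (14), but with same Deg(s) = D … D = 0.75, C₂ = 0.03, C₃ = 0.035, C₄ = 0.035, C₁ = 1 − C₂ − C₃ − C₄.»
* [Volkov2026] S. Volkov, Phys. Rev. A 113, 042823 (2026) = arXiv:2510.02957v2, §III.C (p.11): «The following situations should be avoided: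
  (i) S is infinite (an underestimation of the asymptotic behavior of |F(p,z)| in even a single Hepp sector may lead to this …); (ii) …;
  (iii) extremely large values of |F(p,z)/g(z,p)| occur too early in the integration process and spoil the result (this is possible because
  F(p,z)/g(z,p) is generally unbounded) … To handle (i) and (ii), we introduce stabilization terms … g_min is constructed with Deg(s,p) = R,
  where R > 0 is a constant … C_min = 0.04, R = 0.75».
* [Volkov2017] S. Volkov, Phys. Rev. D 96, 096018 (2017) = arXiv:1705.05800, §III.A (the toy `∫₀¹ a x^{a−1} dx` sampled with `b x^{b−1}`,
  «V(f,g) = a²/(b(2a−b)) − 1», cases (a) bounded / (b) unbounded with finite V / (c) infinite V) — typed in the imported companion.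

READING / MODELLING (flagged). ONE coordinate `x ∈ (0,1]` = one Hepp ratio `t_l`; «exponent» = Volkov's `Deg` on that level: the main component
`g_b = gToy b` (weight `1 − c`, `b` = `Deg` / `Deg₀` of the level), the floor `g_d = gToy d` (weight `c`, `d = D = 0.75` for `g₃` / `g_min`); the
integrand's true exponent is `a` (`|I|·∏z ≍ t^a`, the cell's `E-true`), `fToy a`. The printed densities have MANY levels and several floor
components; this file isolates the one-level mechanism (as PRD 96 §III.A itself does) — the per-level crossover arithmetic quoted in §B.8 / §B.12.3
is the `x×` below with the printed `(c, d)`. Nothing here says which `a` any graph has.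

WHAT THE KERNEL CERTIFIES (all PROVED; Mathlib + the V3a toy only; no named fact, D-0026 net debt 0). Throughout `0 < c < 1`, `0 < b`, `0 < d`.
* §1 `gMix c b d x = (1−c)·gToy b x + c·gToy d x`; `gMix_pos`, `floor_le_gMix`, `main_le_gMix` (each component sits below the mixture);
  the two one-component weight laws `weight_mix_le_floorLaw` (`f/g ≤ (a/(c d))·x^{a−d}`) and `weight_mix_le_mainLaw` (`f/g ≤ (a/((1−c) b))·x^{a−b}`).
* §2 the CROSSOVER `xCross c b d = (c d/((1−c) b))^{1/(b−d)}` (`b > d`): `xCross_pos`, `xCross_rpow` (`x×^{b−d} = c d/((1−c) b)`),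
  `xCross_lt_one` (iff-direction used: `c d < (1−c) b`), **`gMix_balance`** (`(1−c)·g_b(x×) = c·g_d(x×)`), `floor_le_main_of_xCross_le`
  (above the crossover the main component dominates) and `main_le_floor_of_le_xCross` (below it the floor does).
* §3 **`weight_mix_le`** — (i): for `d ≤ a ≤ b` and every `x ∈ (0,1]`, `f_a(x)/g(x) ≤ (a/(c d))·x×^{a−d}` =: `W_max`; `weight_mix_at_xCross`
  (at the crossover the weight equals `W_max/2`: the bound is sharp up to the factor 2); `wMax_eq` (`W_max = (a/((1−c) b))·x×^{a−b}`, the same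
  number read from the main side).
* §4 **`secondMoment_mix_le`** — (ii): `d < 2a` ⇒ `f_a²/g` is interval-integrable on `[0,1]` and `∫₀¹ f_a²/g ≤ c⁻¹·a²/(d(2a−d))`
  (the toy closed form of V3a's general `integral_sq_div_le_of_mul_le`).
* §5 **`secondMoment_mix_ge`** — (iii): `d < 2a < b`, `c d < (1−c) b` ⇒ `∫₀¹ f_a²/g ≥ a²/(2(1−c) b (b−2a))·(x×^{2a−b} − 1)`, with
  `xCross_rpow_neg` (`x×^{2a−b} = ((1−c) b/(c d))^{(b−2a)/(b−d)}`): the second moment is FINITE for every `c > 0` but UNBOUNDED as `c → 0⁺`,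
  polynomially with exponent `(b−2a)/(b−d) ∈ (0,1)`.
NOT claimed: anything about Volkov's actual integrands or the cell's words; a multi-level version; Hill-estimator statements (V3a's
`Literature/Probability/HeavyTails/*` hold those); that `D = 0.75 ≤ a` holds on any face of any graph (that is the E-true question of the track).
-/

namespace Literature.MathematicalPhysics.QuantumFieldTheory.Volkov2024

namespace StabilizationToy

open Real Set MeasureTheory Volkov2017

noncomputable section

/-! ## §1 The two-component mixture and the one-component weight laws -/

/-- The one-level mixture density: main component `g_b` with weight `1 − c`, floor `g_d` with weight `c`.
[cite: Volkov2024, §IV.A «g(z) = C_main × g₀(z) + C_min × g_min(z) + …, Deg_min(s) = D» (arXiv:2404.00649v2 p.9–10); Volkov2018, §IV.E «g = C₁g₁ + C₂g₂ + C₃g₃ + C₄g₄ … g₃ … with same Deg(s) = D» (arXiv:1807.05281 l.1006–1043)] -/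
def gMix (c b d x : ℝ) : ℝ := (1 - c) * gToy b x + c * gToy d x

/-- `g_b(x) > 0` for `x > 0` (positivity helper). [folklore] -/
private theorem gToy_pos {b x : ℝ} (hb : 0 < b) (hx : 0 < x) : 0 < gToy b x := by
  unfold gToy; exact mul_pos hb (rpow_pos_of_pos hx _)

/-- `g_b(x) ≥ 0` for `x ≥ 0` (positivity helper, Mathlib's total `rpow`). [folklore] -/
private theorem gToy_nonneg {b x : ℝ} (hb : 0 < b) (hx : 0 ≤ x) : 0 ≤ gToy b x := by
  unfold gToy; exact mul_nonneg hb.le (rpow_nonneg hx _)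

/-- `f_a(x) ≥ 0` for `x ≥ 0` (positivity helper). [folklore] -/
private theorem fToy_nonneg {a x : ℝ} (ha : 0 < a) (hx : 0 ≤ x) : 0 ≤ fToy a x := by
  unfold fToy; exact mul_nonneg ha.le (rpow_nonneg hx _)

/-- The mixture is a positive density on `(0,1]`. [cite: Volkov2024, §IV.A (arXiv:2404.00649v2 p.9)] -/
theorem gMix_pos {c b d x : ℝ} (hc0 : 0 < c) (hc1 : c < 1) (hb : 0 < b) (hd : 0 < d) (hx : 0 < x) : 0 < gMix c b d x := by
  unfold gMix
  exact add_pos (mul_pos (by linarith) (gToy_pos hb hx)) (mul_pos hc0 (gToy_pos hd hx))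

/-- The mixture is non-negative on `[0, ∞)` (Mathlib's total `rpow` at `x = 0` included). [cite: Volkov2024, §IV.A (arXiv:2404.00649v2 p.9)] -/
theorem gMix_nonneg {c b d x : ℝ} (hc0 : 0 < c) (hc1 : c < 1) (hb : 0 < b) (hd : 0 < d) (hx : 0 ≤ x) : 0 ≤ gMix c b d x := by
  unfold gMix
  exact add_nonneg (mul_nonneg (by linarith) (gToy_nonneg hb hx)) (mul_nonneg hc0.le (gToy_nonneg hd hx))

/-- The floor sits below the mixture: `c·g_d ≤ g`. [cite: Volkov2024, §IV.A «stabilization terms; they prevent from significant underestimation of |I(z)|» (arXiv:2404.00649v2 p.10)] -/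
theorem floor_le_gMix {c b d x : ℝ} (hc1 : c < 1) (hb : 0 < b) (hx : 0 ≤ x) : c * gToy d x ≤ gMix c b d x := by
  unfold gMix
  have : 0 ≤ (1 - c) * gToy b x := mul_nonneg (by linarith) (gToy_nonneg hb hx)
  linarith

/-- The main component sits below the mixture: `(1−c)·g_b ≤ g`. [cite: Volkov2024, §IV.A (arXiv:2404.00649v2 p.9)] -/
theorem main_le_gMix {c b d x : ℝ} (hc0 : 0 < c) (hd : 0 < d) (hx : 0 ≤ x) : (1 - c) * gToy b x ≤ gMix c b d x := by
  unfold gMix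
  have : 0 ≤ c * gToy d x := mul_nonneg hc0.le (gToy_nonneg hd hx)
  linarith

/-- The FLOOR weight law: `f_a/g ≤ (a/(c·d))·x^{a−d}` on `x > 0`.
[cite: Volkov2017, §III.A (the weight `f/g = (a/b)x^{a−b}` of the toy, arXiv:1705.05800 l.519–548); Volkov2024, §IV.A (arXiv:2404.00649v2 p.10)] -/
theorem weight_mix_le_floorLaw {a c b d x : ℝ} (ha : 0 < a) (hc0 : 0 < c) (hc1 : c < 1) (hb : 0 < b) (hd : 0 < d) (hx : 0 < x) :
    fToy a x / gMix c b d x ≤ a / (c * d) * x ^ (a - d) := by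
  have hg : 0 < c * gToy d x := mul_pos hc0 (gToy_pos hd hx)
  calc fToy a x / gMix c b d x ≤ fToy a x / (c * gToy d x) :=
        div_le_div_of_nonneg_left (fToy_nonneg ha hx.le) hg (floor_le_gMix hc1 hb hx.le)
    _ = c⁻¹ * (fToy a x / gToy d x) := by rw [div_mul_eq_div_div_swap]; ring
    _ = c⁻¹ * (a / d * x ^ (a - d)) := by rw [weight_toy_eq a d x hx hd.ne']
    _ = a / (c * d) * x ^ (a - d) := by rw [div_mul_eq_div_div_swap]; ring

/-- The MAIN weight law: `f_a/g ≤ (a/((1−c)·b))·x^{a−b}` on `x > 0`.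
[cite: Volkov2017, §III.A (arXiv:1705.05800 l.519–548); Volkov2024, §IV.A (arXiv:2404.00649v2 p.9)] -/
theorem weight_mix_le_mainLaw {a c b d x : ℝ} (ha : 0 < a) (hc0 : 0 < c) (hc1 : c < 1) (hb : 0 < b) (hd : 0 < d) (hx : 0 < x) :
    fToy a x / gMix c b d x ≤ a / ((1 - c) * b) * x ^ (a - b) := by
  have h1c : 0 < 1 - c := by linarith
  have hg : 0 < (1 - c) * gToy b x := mul_pos h1c (gToy_pos hb hx)
  calc fToy a x / gMix c b d x ≤ fToy a x / ((1 - c) * gToy b x) :=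
        div_le_div_of_nonneg_left (fToy_nonneg ha hx.le) hg (main_le_gMix hc0 hd hx.le)
    _ = (1 - c)⁻¹ * (fToy a x / gToy b x) := by rw [div_mul_eq_div_div_swap]; ring
    _ = (1 - c)⁻¹ * (a / b * x ^ (a - b)) := by rw [weight_toy_eq a b x hx hb.ne']
    _ = a / ((1 - c) * b) * x ^ (a - b) := by rw [div_mul_eq_div_div_swap]; ring

/-! ## §2 The crossover depth -/

/-- The CROSSOVER depth `x× = (c·d/((1−c)·b))^{1/(b−d)}`: where the two components of the mixture are equal (for `b > d`).
[cite: Volkov2024, §IV.A (arXiv:2404.00649v2 p.9–10); the per-level «crossover depth» of `tropical/view/V3-VOLKOV-DEGREES.md` §B.8 / §B.12.3 is this number with the printed (c, d)] -/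
def xCross (c b d : ℝ) : ℝ := (c * d / ((1 - c) * b)) ^ (1 / (b - d))

/-- `c d/((1−c) b) > 0` (positivity helper). [folklore] -/
private theorem ratio_pos {c b d : ℝ} (hc0 : 0 < c) (hc1 : c < 1) (hb : 0 < b) (hd : 0 < d) : 0 < c * d / ((1 - c) * b) :=
  div_pos (mul_pos hc0 hd) (mul_pos (by linarith) hb)

/-- The crossover depth is positive. [cite: Volkov2024, §IV.A (arXiv:2404.00649v2 p.9–10)] -/
theorem xCross_pos {c b d : ℝ} (hc0 : 0 < c) (hc1 : c < 1) (hb : 0 < b) (hd : 0 < d) : 0 < xCross c b d := by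
  unfold xCross; exact rpow_pos_of_pos (ratio_pos hc0 hc1 hb hd) _

/-- `x×^{b−d} = c·d/((1−c)·b)`. [cite: Volkov2024, §IV.A (arXiv:2404.00649v2 p.9–10)] -/
theorem xCross_rpow {c b d : ℝ} (hc0 : 0 < c) (hc1 : c < 1) (hb : 0 < b) (hd : 0 < d) (hbd : d < b) :
    xCross c b d ^ (b - d) = c * d / ((1 - c) * b) := by
  unfold xCross
  rw [← rpow_mul (ratio_pos hc0 hc1 hb hd).le]
  have : 1 / (b - d) * (b - d) = 1 := by field_simp [(sub_pos.2 hbd).ne']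
  rw [this, rpow_one]

/-- A general power of the crossover: `x×^{e} = (c·d/((1−c)·b))^{e/(b−d)}`. [cite: Volkov2024, §IV.A (arXiv:2404.00649v2 p.9–10)] -/
theorem xCross_rpow_eq {c b d : ℝ} (hc0 : 0 < c) (hc1 : c < 1) (hb : 0 < b) (hd : 0 < d) (e : ℝ) :
    xCross c b d ^ e = (c * d / ((1 - c) * b)) ^ (e / (b - d)) := by
  unfold xCross
  rw [← rpow_mul (ratio_pos hc0 hc1 hb hd).le]
  congr 1; ring

/-- The crossover lies inside `(0,1)` exactly when the floor is the SMALLER component at `x = 1`: `c·d < (1−c)·b`.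
[cite: Volkov2024, §IV.A (arXiv:2404.00649v2 p.9–10: C_min = 0.002, D = 0.75 against C_main = 0.918)] -/
theorem xCross_lt_one {c b d : ℝ} (hc0 : 0 < c) (hc1 : c < 1) (hb : 0 < b) (hd : 0 < d) (hbd : d < b)
    (hsmall : c * d < (1 - c) * b) : xCross c b d < 1 := by
  unfold xCross
  have hr1 : c * d / ((1 - c) * b) < 1 := (div_lt_one (mul_pos (by linarith) hb)).2 hsmall
  exact rpow_lt_one (ratio_pos hc0 hc1 hb hd).le hr1 (one_div_pos.2 (sub_pos.2 hbd))

/-- **Balance at the crossover**: `(1−c)·g_b(x×) = c·g_d(x×)`. [cite: Volkov2024, §IV.A (arXiv:2404.00649v2 p.9–10)] -/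
theorem gMix_balance {c b d : ℝ} (hc0 : 0 < c) (hc1 : c < 1) (hb : 0 < b) (hd : 0 < d) (hbd : d < b) :
    (1 - c) * gToy b (xCross c b d) = c * gToy d (xCross c b d) := by
  have hx := xCross_pos hc0 hc1 hb hd
  unfold gToy
  have hsplit : xCross c b d ^ (b - 1) = xCross c b d ^ (d - 1) * xCross c b d ^ (b - d) := by
    rw [← rpow_add hx]; ring_nf
  rw [hsplit, xCross_rpow hc0 hc1 hb hd hbd]
  have h1c : (1 - c) ≠ 0 := by linarith
  field_simp

/-- Above the crossover the MAIN component dominates: `x× ≤ x` ⇒ `c·g_d(x) ≤ (1−c)·g_b(x)` (for `b > d`).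
[cite: Volkov2024, §IV.A (arXiv:2404.00649v2 p.9–10)] -/
theorem floor_le_main_of_xCross_le {c b d x : ℝ} (hc0 : 0 < c) (hc1 : c < 1) (hb : 0 < b) (hd : 0 < d) (hbd : d < b)
    (hx : xCross c b d ≤ x) : c * gToy d x ≤ (1 - c) * gToy b x := by
  have hx0 : 0 < x := lt_of_lt_of_le (xCross_pos hc0 hc1 hb hd) hx
  have hpow : xCross c b d ^ (b - d) ≤ x ^ (b - d) :=
    rpow_le_rpow (xCross_pos hc0 hc1 hb hd).le hx (sub_pos.2 hbd).le
  rw [xCross_rpow hc0 hc1 hb hd hbd] at hpow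
  unfold gToy
  have hsplit : x ^ (b - 1) = x ^ (d - 1) * x ^ (b - d) := by rw [← rpow_add hx0]; ring_nf
  rw [hsplit]
  have hxd : 0 < x ^ (d - 1) := rpow_pos_of_pos hx0 _
  have h1cb : 0 < (1 - c) * b := mul_pos (by linarith) hb
  have key : c * d ≤ (1 - c) * b * x ^ (b - d) := by
    have := mul_le_mul_of_nonneg_left hpow h1cb.le
    rwa [mul_div_cancel₀ _ h1cb.ne'] at this
  calc c * (d * x ^ (d - 1)) = (c * d) * x ^ (d - 1) := by ring
    _ ≤ ((1 - c) * b * x ^ (b - d)) * x ^ (d - 1) := mul_le_mul_of_nonneg_right key hxd.le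
    _ = (1 - c) * (b * (x ^ (d - 1) * x ^ (b - d))) := by ring

/-- Below the crossover the FLOOR dominates: `0 < x ≤ x×` ⇒ `(1−c)·g_b(x) ≤ c·g_d(x)` (for `b > d`).
[cite: Volkov2024, §IV.A (arXiv:2404.00649v2 p.9–10)] -/
theorem main_le_floor_of_le_xCross {c b d x : ℝ} (hc0 : 0 < c) (hc1 : c < 1) (hb : 0 < b) (hd : 0 < d) (hbd : d < b)
    (hx0 : 0 < x) (hx : x ≤ xCross c b d) : (1 - c) * gToy b x ≤ c * gToy d x := by
  have hpow : x ^ (b - d) ≤ xCross c b d ^ (b - d) := rpow_le_rpow hx0.le hx (sub_pos.2 hbd).le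
  rw [xCross_rpow hc0 hc1 hb hd hbd] at hpow
  unfold gToy
  have hsplit : x ^ (b - 1) = x ^ (d - 1) * x ^ (b - d) := by rw [← rpow_add hx0]; ring_nf
  rw [hsplit]
  have hxd : 0 < x ^ (d - 1) := rpow_pos_of_pos hx0 _
  have h1cb : 0 < (1 - c) * b := mul_pos (by linarith) hb
  have key : (1 - c) * b * x ^ (b - d) ≤ c * d := by
    have := mul_le_mul_of_nonneg_left hpow h1cb.le
    rwa [mul_div_cancel₀ _ h1cb.ne'] at this
  calc (1 - c) * (b * (x ^ (d - 1) * x ^ (b - d))) = ((1 - c) * b * x ^ (b - d)) * x ^ (d - 1) := by ring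
    _ ≤ (c * d) * x ^ (d - 1) := mul_le_mul_of_nonneg_right key hxd.le
    _ = c * (d * x ^ (d - 1)) := by ring

/-! ## §3 What the floor buys: a BOUNDED weight as soon as `d ≤ a` -/

/-- The weight bound of the floor regime read from the main side: `(a/((1−c) b))·x×^{a−b} = (a/(c d))·x×^{a−d}`.
[cite: Volkov2024, §IV.A (arXiv:2404.00649v2 p.9–10)] -/
theorem wMax_eq {a c b d : ℝ} (hc0 : 0 < c) (hc1 : c < 1) (hb : 0 < b) (hd : 0 < d) (hbd : d < b) :
    a / ((1 - c) * b) * xCross c b d ^ (a - b) = a / (c * d) * xCross c b d ^ (a - d) := by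
  have hx := xCross_pos hc0 hc1 hb hd
  have hsplit : xCross c b d ^ (a - d) = xCross c b d ^ (a - b) * xCross c b d ^ (b - d) := by
    rw [← rpow_add hx]; ring_nf
  rw [hsplit, xCross_rpow hc0 hc1 hb hd hbd]
  have h1c : (1 - c) ≠ 0 := by linarith
  field_simp

/-- **WHAT THE FLOOR BUYS.** If the floor exponent does not exceed the integrand's (`d ≤ a`) then, whatever the main exponent `b ≥ a`, the
mixture weight is BOUNDED on `(0,∞)` (in particular on the sample space `(0,1]`): `f_a(x)/g(x) ≤ W_max := (a/(c·d))·x×^{a−d}`. (Under the main component alone the weight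
`(a/b)x^{a−b}` is unbounded for `b > a` — PRD 96 §III.A case (b)/(c).)
[cite: Volkov2024, §IV.A «stabilization terms; they prevent from significant underestimation of |I(z)|» (arXiv:2404.00649v2 p.10); Volkov2026, §III.C (iii) «F(p,z)/g(z,p) is generally unbounded» (arXiv:2510.02957v2 p.11); Volkov2017, §III.A cases (a)–(c) (arXiv:1705.05800 l.519–530)] -/
theorem weight_mix_le {a c b d : ℝ} (ha : 0 < a) (hc0 : 0 < c) (hc1 : c < 1) (hb : 0 < b) (hd : 0 < d)
    (hda : d ≤ a) (hab : a ≤ b) (hbd : d < b) {x : ℝ} (hx0 : 0 < x) :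
    fToy a x / gMix c b d x ≤ a / (c * d) * xCross c b d ^ (a - d) := by
  have hxc := xCross_pos hc0 hc1 hb hd
  have hK : 0 ≤ a / (c * d) := div_nonneg ha.le (mul_pos hc0 hd).le
  rcases le_total x (xCross c b d) with hle | hge
  · -- floor regime: the floor law, monotone increasing in x since a − d ≥ 0
    calc fToy a x / gMix c b d x ≤ a / (c * d) * x ^ (a - d) := weight_mix_le_floorLaw ha hc0 hc1 hb hd hx0
      _ ≤ a / (c * d) * xCross c b d ^ (a - d) :=
          mul_le_mul_of_nonneg_left (rpow_le_rpow hx0.le hle (sub_nonneg.2 hda)) hK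
  · -- main regime: the main law, monotone decreasing in x since a − b ≤ 0; at x× it is the same number (wMax_eq)
    have hK' : 0 ≤ a / ((1 - c) * b) := div_nonneg ha.le (mul_pos (by linarith) hb).le
    calc fToy a x / gMix c b d x ≤ a / ((1 - c) * b) * x ^ (a - b) := weight_mix_le_mainLaw ha hc0 hc1 hb hd hx0
      _ ≤ a / ((1 - c) * b) * xCross c b d ^ (a - b) :=
          mul_le_mul_of_nonneg_left
            ((antitoneOn_rpow_Ioi_of_exponent_nonpos (sub_nonpos.2 hab)) (mem_Ioi.2 hxc) (mem_Ioi.2 hx0) hge) hK'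
      _ = a / (c * d) * xCross c b d ^ (a - d) := wMax_eq hc0 hc1 hb hd hbd

/-- The bound of `weight_mix_le` is attained up to the factor 2: at the crossover the weight EQUALS `W_max/2`.
[cite: Volkov2024, §IV.A (arXiv:2404.00649v2 p.9–10)] -/
theorem weight_mix_at_xCross {a c b d : ℝ} (hc0 : 0 < c) (hc1 : c < 1) (hb : 0 < b) (hd : 0 < d) (hbd : d < b) :
    fToy a (xCross c b d) / gMix c b d (xCross c b d) = a / (2 * c * d) * xCross c b d ^ (a - d) := by
  have hx := xCross_pos hc0 hc1 hb hd
  have hgx : gMix c b d (xCross c b d) = 2 * (c * gToy d (xCross c b d)) := by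
    unfold gMix; rw [gMix_balance hc0 hc1 hb hd hbd]; ring
  have hgd : gToy d (xCross c b d) ≠ 0 := (gToy_pos hd hx).ne'
  have hw : fToy a (xCross c b d) = a / d * xCross c b d ^ (a - d) * gToy d (xCross c b d) := by
    rw [← weight_toy_eq a d _ hx hd.ne', div_mul_cancel₀ _ hgd]
  rw [hgx, hw]
  have hc : c ≠ 0 := hc0.ne'
  have hd' : d ≠ 0 := hd.ne'
  field_simp

/-! ## §4 What the floor buys, second moment: `∫₀¹ f²/g ≤ c⁻¹·a²/(d(2a−d))` for `d < 2a` -/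

/-- Pointwise: `f_a²/g ≤ c⁻¹·f_a²/g_d = (a²/(c d))·x^{2a−d−1}` on `x > 0`.
[cite: Volkov2018, §IV.E (arXiv:1807.05281 l.1006–1043); Volkov2024, §IV.A (arXiv:2404.00649v2 p.9–10)] -/
theorem sq_div_gMix_le {a c b d x : ℝ} (hc0 : 0 < c) (hc1 : c < 1) (hb : 0 < b) (hd : 0 < d) (hx : 0 < x) :
    fToy a x ^ 2 / gMix c b d x ≤ a ^ 2 / (c * d) * x ^ (2 * a - d - 1) := by
  have hg : 0 < c * gToy d x := mul_pos hc0 (gToy_pos hd hx)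
  calc fToy a x ^ 2 / gMix c b d x ≤ fToy a x ^ 2 / (c * gToy d x) :=
        div_le_div_of_nonneg_left (sq_nonneg _) hg (floor_le_gMix hc1 hb hx.le)
    _ = c⁻¹ * (fToy a x ^ 2 / gToy d x) := by rw [div_mul_eq_div_div_swap]; ring
    _ = c⁻¹ * (a ^ 2 / d * x ^ (2 * a - d - 1)) := by rw [sq_div_toy_eq a d x hx hd.ne']
    _ = a ^ 2 / (c * d) * x ^ (2 * a - d - 1) := by rw [div_mul_eq_div_div_swap]; ring

/-- Pointwise lower bound above the crossover: `x× ≤ x` ⇒ `f_a²/g ≥ (a²/(2(1−c) b))·x^{2a−b−1}` (there `g ≤ 2(1−c)g_b`).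
[cite: Volkov2024, §IV.A (arXiv:2404.00649v2 p.9–10); Volkov2020, §1 «a total overestimation of this growth rate leads to poor convergence too» (arXiv:1912.04885v4 tex l.121)] -/
theorem sq_div_gMix_ge {a c b d x : ℝ} (hc0 : 0 < c) (hc1 : c < 1) (hb : 0 < b) (hd : 0 < d) (hbd : d < b)
    (hx : xCross c b d ≤ x) :
    a ^ 2 / (2 * (1 - c) * b) * x ^ (2 * a - b - 1) ≤ fToy a x ^ 2 / gMix c b d x := by
  have hx0 : 0 < x := lt_of_lt_of_le (xCross_pos hc0 hc1 hb hd) hx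
  have h1c : 0 < 1 - c := by linarith
  have hgb : 0 < (1 - c) * gToy b x := mul_pos h1c (gToy_pos hb hx0)
  have hle : gMix c b d x ≤ 2 * ((1 - c) * gToy b x) := by
    unfold gMix; have := floor_le_main_of_xCross_le hc0 hc1 hb hd hbd hx; linarith
  have hgb0 : gToy b x ≠ 0 := (gToy_pos hb hx0).ne'
  have hsq : fToy a x ^ 2 = a ^ 2 / b * x ^ (2 * a - b - 1) * gToy b x := by
    rw [← sq_div_toy_eq a b x hx0 hb.ne', div_mul_cancel₀ _ hgb0]
  have h1c' : (1 - c) ≠ 0 := h1c.ne'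
  have hb' : b ≠ 0 := hb.ne'
  calc a ^ 2 / (2 * (1 - c) * b) * x ^ (2 * a - b - 1) = fToy a x ^ 2 / (2 * ((1 - c) * gToy b x)) := by
        rw [hsq]; field_simp
    _ ≤ fToy a x ^ 2 / gMix c b d x :=
        div_le_div_of_nonneg_left (sq_nonneg _) (gMix_pos hc0 hc1 hb hd hx0) hle

/-- Measurability of the toy integrand `f_a²/g` (a quotient of continuous-on-`(0,∞)` power functions; stated for all of `ℝ` with
Mathlib's total `rpow`). [folklore] -/
private theorem measurable_sq_div_gMix (a c b d : ℝ) : Measurable fun x : ℝ => fToy a x ^ 2 / gMix c b d x := by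
  unfold fToy gMix gToy
  fun_prop

/-- **WHAT THE FLOOR BUYS, second moment.** For `d < 2a` the toy second moment under the mixture is finite for EVERY main exponent `b`,
and at most `c⁻¹·a²/(d(2a−d))` — the toy closed form of V3a's general `Volkov2018.integral_sq_div_le_of_mul_le` («patching costs at most the
factor C_j⁻¹»). [cite: Volkov2018, §IV.E (arXiv:1807.05281 l.1006–1043); Volkov2024, §IV.A (arXiv:2404.00649v2 p.9–10); Volkov2026, §III.C (i) «S is infinite … To handle (i) and (ii), we introduce stabilization terms» (arXiv:2510.02957v2 p.11)] -/
theorem secondMoment_mix_le {a c b d : ℝ} (ha : 0 < a) (hc0 : 0 < c) (hc1 : c < 1) (hb : 0 < b) (hd : 0 < d) (hd2 : d < 2 * a) :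
    IntervalIntegrable (fun x => fToy a x ^ 2 / gMix c b d x) volume 0 1 ∧
    ∫ x in (0 : ℝ)..1, fToy a x ^ 2 / gMix c b d x ≤ c⁻¹ * (a ^ 2 / (d * (2 * a - d))) := by
  have hr : -1 < 2 * a - d - 1 := by linarith
  -- the dominating power function and its integral
  have hdom : IntervalIntegrable (fun x : ℝ => a ^ 2 / (c * d) * x ^ (2 * a - d - 1)) volume 0 1 :=
    (intervalIntegral.intervalIntegrable_rpow' hr).const_mul _
  have hint : IntervalIntegrable (fun x => fToy a x ^ 2 / gMix c b d x) volume 0 1 := by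
    refine hdom.mono_fun' (measurable_sq_div_gMix a c b d).aestronglyMeasurable ?_
    rw [Filter.EventuallyLE, ae_restrict_iff' measurableSet_uIoc]
    refine Filter.Eventually.of_forall fun x hx => ?_
    rw [uIoc_of_le zero_le_one] at hx
    rw [Real.norm_eq_abs, abs_of_nonneg (div_nonneg (sq_nonneg _) (gMix_pos hc0 hc1 hb hd hx.1).le)]
    exact sq_div_gMix_le hc0 hc1 hb hd hx.1
  refine ⟨hint, ?_⟩
  calc ∫ x in (0 : ℝ)..1, fToy a x ^ 2 / gMix c b d x
        ≤ ∫ x in (0 : ℝ)..1, a ^ 2 / (c * d) * x ^ (2 * a - d - 1) :=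
          intervalIntegral.integral_mono_on_of_le_Ioo zero_le_one hint hdom
            fun x hx => sq_div_gMix_le hc0 hc1 hb hd hx.1
    _ = a ^ 2 / (c * d) * (1 / (2 * a - d)) := by
          rw [intervalIntegral.integral_const_mul, integral_rpow (Or.inl hr)]
          have h1 : 2 * a - d - 1 + 1 = 2 * a - d := by ring
          rw [h1, one_rpow, zero_rpow (by linarith : 2 * a - d ≠ 0), sub_zero]
    _ = c⁻¹ * (a ^ 2 / (d * (2 * a - d))) := by
          have hd' : d ≠ 0 := hd.ne'
          have h2 : 2 * a - d ≠ 0 := by linarith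
          field_simp

/-! ## §5 What the floor costs: the second moment blows up like `c^{−(b−2a)/(b−d)}` as `c → 0⁺` when `b > 2a` -/

/-- `x×^{2a−b} = ((1−c) b/(c d))^{(b−2a)/(b−d)}` — the factor by which the lower bound grows as the floor weight `c` shrinks.
[cite: Volkov2024, §IV.A (arXiv:2404.00649v2 p.9–10)] -/
theorem xCross_rpow_neg {a c b d : ℝ} (hc0 : 0 < c) (hc1 : c < 1) (hb : 0 < b) (hd : 0 < d) :
    xCross c b d ^ (2 * a - b) = ((1 - c) * b / (c * d)) ^ ((b - 2 * a) / (b - d)) := by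
  rw [xCross_rpow_eq hc0 hc1 hb hd, ← inv_div ((1 - c) * b) (c * d), inv_rpow (le_of_lt (div_pos (mul_pos (by linarith) hb) (mul_pos hc0 hd))),
    ← rpow_neg_one, ← rpow_mul (le_of_lt (div_pos (mul_pos (by linarith) hb) (mul_pos hc0 hd)))]
  congr 1
  have : b - d ≠ 0 ∨ True := Or.inr trivial
  field_simp
  ring

/-- **WHAT THE FLOOR COSTS.** For `d < 2a < b` (main component alone: infinite second moment; floor: finite) and a floor small enough that the
crossover lies inside `(0,1)` (`c d < (1−c) b`), the toy second moment under the mixture is at least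
`a²/(2(1−c)·b·(b−2a))·(x×^{2a−b} − 1)`, where `x×^{2a−b} = ((1−c) b/(c d))^{(b−2a)/(b−d)} → ∞` as `c → 0⁺`: the variance the floor
delivers is finite but LARGE, polynomially in `1/c` with exponent `(b−2a)/(b−d)`.
[cite: Volkov2020, §1 «an underestimation … leads to an infinite value ∫ f(z)²/g(z)dz … a total overestimation of this growth rate leads to poor convergence too» (arXiv:1912.04885v4 tex l.121); Volkov2024, §IV.A (arXiv:2404.00649v2 p.9–10: C_min = 0.002) and §IV.B.1 «examples of high order are known that result in an infinite integral» (p.10); Volkov2026, §III.C (i)–(iii) (arXiv:2510.02957v2 p.11)] -/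
theorem secondMoment_mix_ge {a c b d : ℝ} (ha : 0 < a) (hc0 : 0 < c) (hc1 : c < 1) (hb : 0 < b) (hd : 0 < d)
    (hd2 : d < 2 * a) (h2b : 2 * a < b) (hsmall : c * d < (1 - c) * b) :
    a ^ 2 / (2 * (1 - c) * b * (b - 2 * a)) * (xCross c b d ^ (2 * a - b) - 1) ≤
      ∫ x in (0 : ℝ)..1, fToy a x ^ 2 / gMix c b d x := by
  have hbd : d < b := by linarith
  set e := xCross c b d with he
  have he0 : 0 < e := xCross_pos hc0 hc1 hb hd
  have he1 : e < 1 := xCross_lt_one hc0 hc1 hb hd hbd hsmall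
  obtain ⟨hint, -⟩ := secondMoment_mix_le ha hc0 hc1 hb hd hd2
  -- split ∫₀¹ = ∫₀^e + ∫_e^1 and drop the first (non-negative) piece
  have hint0e : IntervalIntegrable (fun x => fToy a x ^ 2 / gMix c b d x) volume 0 e :=
    hint.mono_set (by rw [uIcc_of_le zero_le_one, uIcc_of_le he0.le]; exact Icc_subset_Icc le_rfl he1.le)
  have hinte1 : IntervalIntegrable (fun x => fToy a x ^ 2 / gMix c b d x) volume e 1 :=
    hint.mono_set (by rw [uIcc_of_le zero_le_one, uIcc_of_le he1.le]; exact Icc_subset_Icc he0.le le_rfl)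
  have hsplit := intervalIntegral.integral_add_adjacent_intervals hint0e hinte1
  have hnn : 0 ≤ ∫ x in (0 : ℝ)..e, fToy a x ^ 2 / gMix c b d x :=
    intervalIntegral.integral_nonneg he0.le fun x hx =>
      div_nonneg (sq_nonneg _) (gMix_nonneg hc0 hc1 hb hd hx.1)
  -- the lower power function on [e, 1] and its integral (V3a's truncated second moment, through the pointwise identity)
  have hr : IntervalIntegrable (fun x : ℝ => a ^ 2 / (2 * (1 - c) * b) * x ^ (2 * a - b - 1)) volume e 1 := by
    refine ((intervalIntegral.intervalIntegrable_rpow (r := 2 * a - b - 1) ?_)).const_mul _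
    exact Or.inr (by rw [uIcc_of_le he1.le]; exact fun h => (lt_irrefl (0 : ℝ)) (lt_of_lt_of_le he0 h.1))
  have hlow : ∫ x in e..1, a ^ 2 / (2 * (1 - c) * b) * x ^ (2 * a - b - 1) =
      a ^ 2 / (2 * (1 - c) * b * (b - 2 * a)) * (e ^ (2 * a - b) - 1) := by
    rw [intervalIntegral.integral_const_mul, integral_rpow]
    · have h1 : 2 * a - b - 1 + 1 = 2 * a - b := by ring
      rw [h1, one_rpow]
      have key : (1 - e ^ (2 * a - b)) / (2 * a - b) = (e ^ (2 * a - b) - 1) / (b - 2 * a) := by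
        rw [show b - 2 * a = -(2 * a - b) by ring, div_neg, neg_div', neg_sub]
      rw [key, show a ^ 2 / (2 * (1 - c) * b * (b - 2 * a)) * (e ^ (2 * a - b) - 1)
            = a ^ 2 / (2 * (1 - c) * b) * ((e ^ (2 * a - b) - 1) / (b - 2 * a)) by
            rw [← div_div, div_mul_eq_mul_div, mul_div_assoc]]
    · exact Or.inr ⟨by linarith, by rw [uIcc_of_le he1.le]; exact fun h => (lt_irrefl (0 : ℝ)) (lt_of_lt_of_le he0 h.1)⟩
  calc a ^ 2 / (2 * (1 - c) * b * (b - 2 * a)) * (e ^ (2 * a - b) - 1)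
        = ∫ x in e..1, a ^ 2 / (2 * (1 - c) * b) * x ^ (2 * a - b - 1) := hlow.symm
    _ ≤ ∫ x in e..1, fToy a x ^ 2 / gMix c b d x :=
        intervalIntegral.integral_mono_on_of_le_Ioo he1.le hr hinte1 fun x hx => sq_div_gMix_ge hc0 hc1 hb hd hbd hx.1.le
    _ ≤ (∫ x in (0 : ℝ)..e, fToy a x ^ 2 / gMix c b d x) + ∫ x in e..1, fToy a x ^ 2 / gMix c b d x :=
        le_add_of_nonneg_left hnn
    _ = ∫ x in (0 : ℝ)..1, fToy a x ^ 2 / gMix c b d x := hsplit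

/-! ## §6 Volkov's printed floor constants in the toy (arithmetic only) -/

/-- The printed floors all use the exponent `D = R = 0.75` (2018 `g₃`, 2024 `g_min`, 2026 `g_min`): in the toy, `weight_mix_le`'s hypothesis
`d ≤ a` reads «the integrand's exponent on the level is at least 0.75», and `secondMoment_mix_le`'s `d < 2a` reads «at least 0.375».
[cite: Volkov2018, §IV.E «D = 0.75»; Volkov2024, §IV.A «D = 0.75»; Volkov2026, §III.C «R = 0.75»] -/
theorem printed_floor_thresholds : (0.75 : ℝ) / 2 = 0.375 ∧ ∀ a : ℝ, (0.75 : ℝ) < 2 * a ↔ 0.375 < a := by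
  refine ⟨by norm_num, fun a => ?_⟩
  constructor <;> intro h <;> linarith

/-- The printed floor weights against the main weight satisfy `xCross_lt_one`'s smallness condition `c·d < (1−c)·b` for every main exponent
`b ≥ d = 0.75`: 2018 (`c = C₃ = 0.035`), 2024 (`c = C_min = 0.002`), 2026 (`c = C_min = 0.04`).
[cite: Volkov2018, §IV.E (15); Volkov2024, §IV.A; Volkov2026, §III.C (arXiv:2510.02957v2 p.11)] -/
theorem printed_floor_small (b : ℝ) (hb : (0.75 : ℝ) ≤ b) :
    (0.035 : ℝ) * 0.75 < (1 - 0.035) * b ∧ (0.002 : ℝ) * 0.75 < (1 - 0.002) * b ∧ (0.04 : ℝ) * 0.75 < (1 - 0.04) * b := by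
  refine ⟨?_, ?_, ?_⟩ <;> nlinarith

end

end StabilizationToy

end Literature.MathematicalPhysics.QuantumFieldTheory.Volkov2024
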